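import Mathlib
import Literature.Combinatorics.Additive.TripleProductProperty
import Literature.Computability.AlgebraicComplexity.GroupTheoreticMatMul
import Literature.Computability.AlgebraicComplexity.GroupTheoreticMatMulThmBProofs

/-!
# The Cohn–Kleinberg–Szegedy–Umans pair of punctured-axes triples in `(ℤ/n)³` is an STPP family (every `n`)

Cohn–Kleinberg–Szegedy–Umans 2005, §5 (the example following Def. 5.1, Prop. 5.2 in the cell's numbering;
Prop. 28 of the arXiv version): in `H = Cyc_n³ = H₁ × H₂ × H₃` put `Ĥᵢ = Hᵢ ∖ {0}` (the punctured
coordinate axes); then the two triples `(Ĥ₁, Ĥ₂, Ĥ₃)` and `(Ĥ₂, Ĥ₃, Ĥ₁)` satisfy the simultaneous triple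
product property, so `H` simultaneously realizes `⟨n−1, n−1, n−1⟩` twice (`2 (n−1)^ω ≤ n³` by Thm. 5.5; best
at `n = 16`: `ω ≤ 2.8155…`).  The tree so far certified this only at `n = 5` by a Boolean check
(`Summit.MatrixMultiplication.OmegaCensus.omega_le_of_stpp_cyc5_prop28`); here it is proved for EVERY
modulus `n`, in both conventions of the tree, with the axes given by membership hypotheses (so any explicit
encoding — `cyc5Axis`, `Finset.filter`, … — instantiates):

* `isSTPP_puncturedAxes_pair` — census predicate `IsSTPP ![P₀, P₁] ![P₁, P₂] ![P₂, P₀]` on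
  `ZMod n × ZMod n × ZMod n`;
* `addSimultaneousTPP_puncturedAxes_pair` — `AddSimultaneousTPP` (additive CKSU Def. 5.1) for a
  `Fin 2`-indexed family on `Fin 3 → ZMod n` whose member `0` is the axes triple `(P₀, P₁, P₂)` and whose
  member `1` is `(P₁, P₂, P₀)`.

Proof: of the eight index patterns `(i,j,k)` of the one-clause form, the two constant ones reduce to
coordinatewise cancellation, and each of the six mixed ones has a coordinate to which exactly one of the six
elements contributes a non-zero entry.

## References
* [CohnKleinbergSzegedyUmans2005] H. Cohn, R. Kleinberg, B. Szegedy, C. Umans, *Group-theoretic algorithms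
  for matrix multiplication*, FOCS 2005 (arXiv:math/0511460), Def. 5.1 and the `Cyc_n³` example of §5
  (Prop. 5.2).
-/

namespace Literature.Computability.AlgebraicComplexity

open Finset Literature.Combinatorics.Additive

section Prod

variable {n : ℕ} {P₀ P₁ P₂ : Finset (ZMod n × ZMod n × ZMod n)}

/-- **CKSU's two punctured-axes triples are an STPP family** (census convention, every modulus `n`): with
`P₀ = {(x,0,0) : x ≠ 0}`, `P₁ = {(0,y,0) : y ≠ 0}`, `P₂ = {(0,0,z) : z ≠ 0}` in `(ℤ/n)³` (membership
hypotheses), `IsSTPP ![P₀, P₁] ![P₁, P₂] ![P₂, P₀]`. [cite: CohnKleinbergSzegedyUmans2005, Prop. 5.2] -/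
theorem isSTPP_puncturedAxes_pair
    (hP₀ : ∀ v, v ∈ P₀ ↔ v.1 ≠ 0 ∧ v.2.1 = 0 ∧ v.2.2 = 0)
    (hP₁ : ∀ v, v ∈ P₁ ↔ v.2.1 ≠ 0 ∧ v.1 = 0 ∧ v.2.2 = 0)
    (hP₂ : ∀ v, v ∈ P₂ ↔ v.2.2 ≠ 0 ∧ v.1 = 0 ∧ v.2.1 = 0) :
    IsSTPP ![P₀, P₁] ![P₁, P₂] ![P₂, P₀] := by
  intro i j k s hs s' hs' t ht t' ht' u hu u' hu' h0
  have h1 := congrArg Prod.fst h0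
  have h2 := congrArg (fun v => v.2.1) h0
  have h3 := congrArg (fun v => v.2.2) h0
  simp only [Prod.fst_add, Prod.fst_sub, Prod.snd_add, Prod.snd_sub, Prod.fst_zero, Prod.snd_zero]
    at h1 h2 h3
  fin_cases i <;> fin_cases j <;> fin_cases k <;>
    simp only [Fin.zero_eta, Fin.mk_one, Fin.isValue, Matrix.cons_val_zero, Matrix.cons_val_one,
      hP₀, hP₁, hP₂] at hs hs' ht ht' hu hu'
  · -- (0,0,0): `s, s' ∈ P₀`, `t, t' ∈ P₁`, `u, u' ∈ P₂`
    obtain ⟨-, hs2, hs3⟩ := hs; obtain ⟨-, hs'2, hs'3⟩ := hs'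
    obtain ⟨-, ht1, ht3⟩ := ht; obtain ⟨-, ht'1, ht'3⟩ := ht'
    obtain ⟨-, hu1, hu2⟩ := hu; obtain ⟨-, hu'1, hu'2⟩ := hu'
    refine ⟨rfl, rfl, Prod.ext ?_ (Prod.ext ?_ ?_), Prod.ext ?_ (Prod.ext ?_ ?_),
      Prod.ext ?_ (Prod.ext ?_ ?_)⟩
    · linear_combination -h1 + ht'1 - ht1 + hu'1 - hu1
    · rw [hs2, hs'2]
    · rw [hs3, hs'3]
    · rw [ht1, ht'1]
    · linear_combination -h2 + hs'2 - hs2 + hu'2 - hu2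
    · rw [ht3, ht'3]
    · rw [hu1, hu'1]
    · rw [hu2, hu'2]
    · linear_combination -h3 + hs'3 - hs3 + ht'3 - ht3
  · -- (0,0,1): `s ∈ P₁, s' ∈ P₀, t, t' ∈ P₁, u ∈ P₂, u' ∈ P₀`; coordinate 2 sees only `u`
    exfalso; apply hu.1
    linear_combination -h3 + hs'.2.2 - hs.2.2 + ht'.2.2 - ht.2.2 + hu'.2.2
  · -- (0,1,0): `s, s' ∈ P₀, t ∈ P₁, t' ∈ P₂, u ∈ P₀, u' ∈ P₂`; coordinate 1 sees only `t`
    exfalso; apply ht.1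
    linear_combination -h2 + hs'.2.1 - hs.2.1 + ht'.2.2 + hu'.2.2 - hu.2.1
  · -- (0,1,1): `s ∈ P₁, s' ∈ P₀, t ∈ P₁, t' ∈ P₂, u, u' ∈ P₀`; coordinate 2 sees only `t'`
    exfalso; apply ht'.1
    linear_combination h3 - hs'.2.2 + hs.2.2 + ht.2.2 - hu'.2.2 + hu.2.2
  · -- (1,0,0): `s ∈ P₀, s' ∈ P₁, t ∈ P₂, t' ∈ P₁, u, u' ∈ P₂`; coordinate 0 sees only `s`
    exfalso; apply hs.1
    linear_combination -h1 + hs'.2.1 + ht'.2.1 - ht.2.1 + hu'.2.1 - hu.2.1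
  · -- (1,0,1): `s, s' ∈ P₁, t ∈ P₂, t' ∈ P₁, u ∈ P₂, u' ∈ P₀`; coordinate 0 sees only `u'`
    exfalso; apply hu'.1
    linear_combination h1 - hs'.2.1 + hs.2.1 - ht'.2.1 + ht.2.1 + hu.2.1
  · -- (1,1,0): `s ∈ P₀, s' ∈ P₁, t, t' ∈ P₂, u ∈ P₀, u' ∈ P₂`; coordinate 1 sees only `s'`
    exfalso; apply hs'.1
    linear_combination h2 + hs.2.1 - ht'.2.2 + ht.2.2 - hu'.2.2 + hu.2.1
  · -- (1,1,1): `s, s' ∈ P₁`, `t, t' ∈ P₂`, `u, u' ∈ P₀`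
    obtain ⟨-, hs1, hs3⟩ := hs; obtain ⟨-, hs'1, hs'3⟩ := hs'
    obtain ⟨-, ht1, ht2⟩ := ht; obtain ⟨-, ht'1, ht'2⟩ := ht'
    obtain ⟨-, hu2, hu3⟩ := hu; obtain ⟨-, hu'2, hu'3⟩ := hu'
    refine ⟨rfl, rfl, Prod.ext ?_ (Prod.ext ?_ ?_), Prod.ext ?_ (Prod.ext ?_ ?_),
      Prod.ext ?_ (Prod.ext ?_ ?_)⟩
    · rw [hs1, hs'1]
    · linear_combination -h2 + ht'2 - ht2 + hu'2 - hu2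
    · rw [hs3, hs'3]
    · rw [ht1, ht'1]
    · rw [ht2, ht'2]
    · linear_combination -h3 + hs'3 - hs3 + hu'3 - hu3
    · linear_combination -h1 + hs'1 - hs1 + ht'1 - ht1
    · rw [hu2, hu'2]
    · rw [hu3, hu'3]

end Prod

/-! ### Pulling an STPP family back along an injective additive map; the `Fin 3 → ZMod n` form -/

section Pullback

variable {G G' : Type*} [AddCommGroup G] [AddCommGroup G'] [DecidableEq G'] {ι : Type*}
  {A B C : ι → Finset G}

/-- If the images of the sets of a family under an injective additive map form an STPP family, so does the
family itself (the relations push forward, the conclusions pull back by injectivity).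
[cite: CohnKleinbergSzegedyUmans2005, Def. 5.1] -/
theorem addSimultaneousTPP_of_image (f : G →+ G') (hf : Function.Injective f)
    (h : AddSimultaneousTPP (fun i => (A i).image f) (fun i => (B i).image f)
      (fun i => (C i).image f)) :
    AddSimultaneousTPP A B C := by
  rw [addSimultaneousTPP_iff_forall] at h ⊢
  intro i j k s hs s' hs' t ht t' ht' u hu u' hu' h0
  have h0' : (f s' - f s) + (f t' - f t) + (f u' - f u) = 0 := by
    have := congrArg f h0
    simpa only [map_add, map_sub, map_zero] using this
  obtain ⟨hij, hjk, e1, e2, e3⟩ := h i j k (f s) (Finset.mem_image_of_mem f hs) (f s')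
    (Finset.mem_image_of_mem f hs') (f t) (Finset.mem_image_of_mem f ht) (f t')
    (Finset.mem_image_of_mem f ht') (f u) (Finset.mem_image_of_mem f hu) (f u')
    (Finset.mem_image_of_mem f hu') h0'
  exact ⟨hij, hjk, hf e1, hf e2, hf e3⟩

end Pullback

section Pi

variable {n : ℕ} {A B C : Fin 2 → Finset (Fin 3 → ZMod n)}

/-- **CKSU's two punctured-axes triples are an STPP family**, `Fin 3 → ZMod n` form (additive CKSU
Def. 5.1, `AddSimultaneousTPP`, index `0` = the axes triple `(P₀, P₁, P₂)`, index `1` = its cyclic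
relabeling `(P₁, P₂, P₀)`; punctured axes by membership hypotheses), every modulus `n`.
[cite: CohnKleinbergSzegedyUmans2005, Prop. 5.2] -/
theorem addSimultaneousTPP_puncturedAxes_pair
    (hA0 : ∀ x, x ∈ A 0 ↔ x 0 ≠ 0 ∧ ∀ j, j ≠ 0 → x j = 0)
    (hB0 : ∀ x, x ∈ B 0 ↔ x 1 ≠ 0 ∧ ∀ j, j ≠ 1 → x j = 0)
    (hC0 : ∀ x, x ∈ C 0 ↔ x 2 ≠ 0 ∧ ∀ j, j ≠ 2 → x j = 0)
    (hA1 : ∀ x, x ∈ A 1 ↔ x 1 ≠ 0 ∧ ∀ j, j ≠ 1 → x j = 0)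
    (hB1 : ∀ x, x ∈ B 1 ↔ x 2 ≠ 0 ∧ ∀ j, j ≠ 2 → x j = 0)
    (hC1 : ∀ x, x ∈ C 1 ↔ x 0 ≠ 0 ∧ ∀ j, j ≠ 0 → x j = 0) :
    AddSimultaneousTPP A B C := by
  classical
  -- the coordinate isomorphism onto the product
  let f : (Fin 3 → ZMod n) →+ (ZMod n × ZMod n × ZMod n) :=
    { toFun := fun x => (x 0, x 1, x 2)
      map_zero' := rfl
      map_add' := fun x y => rfl }
  have hf : Function.Injective f := by
    intro x y h
    simp only [f, AddMonoidHom.coe_mk, ZeroHom.coe_mk, Prod.mk.injEq] at h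
    funext i
    fin_cases i
    · exact h.1
    · exact h.2.1
    · exact h.2.2
  -- membership descriptions of the image sets
  have d0 : ∀ (X : Finset (Fin 3 → ZMod n)), (∀ x, x ∈ X ↔ x 0 ≠ 0 ∧ ∀ j, j ≠ 0 → x j = 0) →
      ∀ v, v ∈ X.image f ↔ v.1 ≠ 0 ∧ v.2.1 = 0 ∧ v.2.2 = 0 := by
    intro X hX v
    constructor
    · intro hv
      obtain ⟨x, hx, rfl⟩ := Finset.mem_image.1 hv
      obtain ⟨h0, hj⟩ := (hX x).1 hx
      exact ⟨h0, hj 1 (by decide), hj 2 (by decide)⟩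
    · rintro ⟨h0, h1, h2⟩
      refine Finset.mem_image.2 ⟨![v.1, v.2.1, v.2.2], (hX _).2 ⟨h0, fun j hj => ?_⟩, ?_⟩
      · fin_cases j
        · exact absurd rfl hj
        · exact h1
        · exact h2
      · simp [f]
  have d1 : ∀ (X : Finset (Fin 3 → ZMod n)), (∀ x, x ∈ X ↔ x 1 ≠ 0 ∧ ∀ j, j ≠ 1 → x j = 0) →
      ∀ v, v ∈ X.image f ↔ v.2.1 ≠ 0 ∧ v.1 = 0 ∧ v.2.2 = 0 := by
    intro X hX v
    constructor
    · intro hv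
      obtain ⟨x, hx, rfl⟩ := Finset.mem_image.1 hv
      obtain ⟨h0, hj⟩ := (hX x).1 hx
      exact ⟨h0, hj 0 (by decide), hj 2 (by decide)⟩
    · rintro ⟨h0, h1, h2⟩
      refine Finset.mem_image.2 ⟨![v.1, v.2.1, v.2.2], (hX _).2 ⟨h0, fun j hj => ?_⟩, ?_⟩
      · fin_cases j
        · exact h1
        · exact absurd rfl hj
        · exact h2
      · simp [f]
  have d2 : ∀ (X : Finset (Fin 3 → ZMod n)), (∀ x, x ∈ X ↔ x 2 ≠ 0 ∧ ∀ j, j ≠ 2 → x j = 0) →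
      ∀ v, v ∈ X.image f ↔ v.2.2 ≠ 0 ∧ v.1 = 0 ∧ v.2.1 = 0 := by
    intro X hX v
    constructor
    · intro hv
      obtain ⟨x, hx, rfl⟩ := Finset.mem_image.1 hv
      obtain ⟨h0, hj⟩ := (hX x).1 hx
      exact ⟨h0, hj 0 (by decide), hj 1 (by decide)⟩
    · rintro ⟨h0, h1, h2⟩
      refine Finset.mem_image.2 ⟨![v.1, v.2.1, v.2.2], (hX _).2 ⟨h0, fun j hj => ?_⟩, ?_⟩
      · fin_cases j
        · exact h1
        · exact h2
        · exact absurd rfl hj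
      · simp [f]
  -- `A 0` and `C 1` have the same members, etc.
  have eA : (A 1).image f = (B 0).image f := by
    ext v; rw [d1 _ hA1, d1 _ hB0]
  have eB : (B 1).image f = (C 0).image f := by
    ext v; rw [d2 _ hB1, d2 _ hC0]
  have eC : (C 1).image f = (A 0).image f := by
    ext v; rw [d0 _ hC1, d0 _ hA0]
  have key := isSTPP_puncturedAxes_pair (d0 _ hA0) (d1 _ hB0) (d2 _ hC0)
  rw [isSTPP_iff_addSimultaneousTPP] at key
  refine addSimultaneousTPP_of_image f hf ?_
  have e1 : (fun i => (A i).image ⇑f) = ![(A 0).image f, (B 0).image f] := by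
    funext i; fin_cases i
    · rfl
    · exact eA
  have e2 : (fun i => (B i).image ⇑f) = ![(B 0).image f, (C 0).image f] := by
    funext i; fin_cases i
    · rfl
    · exact eB
  have e3 : (fun i => (C i).image ⇑f) = ![(C 0).image f, (A 0).image f] := by
    funext i; fin_cases i
    · rfl
    · exact eC
  rw [e1, e2, e3]
  exact key

end Pi

end Literature.Computability.AlgebraicComplexity
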